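import Literature.Analysis.Calculus.ClosedSubgroupExpChart
import Literature.Analysis.Matrix.DetExp
import Summits.Ventures.LatticeQCDFlow.Scaling.SmallBallChartLimit
import Summits.Ventures.LatticeQCDFlow.Scaling.CalibratedWindow
import Summits.Ventures.LatticeQCDFlow.Scaling.ExactTransportSUN

/-!
# LatticeQCDFlow / Scaling — exact small-ball asymptotics of `SU(N)` (exponential chart) and the CONSTANT-FREE calibrated window laws

HONEST FRAMING: exact (Metropolis-corrected) sampling algorithms for lattice gauge theory; figures of merit are
autocorrelation/cost numbers at stated couplings and volumes; no continuum-physics claim.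

Venture `LatticeQCDFlow` (cell pub-lqcd), topic `Scaling`, FANOUT row 30 (lean-1) — OUR WORK, discharging theory-2's
hypothesis item `SmallBallAsymptotics` (`Scaling/CalibratedWindowSteps.lean`, THEORY-2.md §3.3 v2.9) for the special
unitary group `SU(N)`, `N ≥ 1`, with the Hilbert–Schmidt (Frobenius) distance — `SU(3)` included:

* §1 `suAlg N` — the Lie algebra `𝔰𝔲(N)` (traceless skew-Hermitian matrices) as the kernel of `a ↦ Im tr(skewOf a)`
  in the Hilbert–Schmidt-isometric coordinates `ℝ^{N²} ≅ 𝔲(N)` of `Literature/…/UnitaryCayleyChart`;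
  `finrank_suAlg : dim 𝔰𝔲(N) = N² - 1`;
* §2 `suChart` — the EXPONENTIAL CHART `a ↦ exp(skewOf a) ∈ SU(N)` (`det exp = exp tr`,
  `Literature.Analysis.Matrix.det_exp_eq_exp_trace`); it is `(1+ε)`-bi-Lipschitz on small balls for every `ε > 0`
  (`exp` is strictly differentiable at `0` with derivative the identity, Mathlib `hasStrictFDerivAt_exp_zero`) and
  FILLS `SU(N)` near `1` (`suChart_fill`: von Neumann's exponential chart of the closed linear group `SU(N)`,
  `Literature.Analysis.Calculus.ClosedSubgroupExpChart.exists_exp_chart_of_isClosed`, its one-parameter generators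
  being traceless skew-Hermitian by differentiating `exp(tX)ᴴ exp(tX) = 1` and `det exp(tX) = 1` at `t = 0`);
* §3 `SUN.exists_tendsto_haar_closedBall_div_pow` — `Haar(B̄(1, t))/t^{N²-1} → C₀ ∈ (0, ∞)` as `t → 0⁺`
  (the abstract engine `Scaling/SmallBallChartLimit.lean`); **`SUN.smallBallAsymptotics N : SmallBallAsymptotics
  SU(N) (N·N - 1)`** — the item DISCHARGED; and the CONSTANT-FREE calibrated window laws
  **`SUN.calibratedCoolingWindow_zero d N`**, `SUN.calibratedHeatingWindow_zero d N`, NO hypothesis left: every exact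
  `K`-Lipschitz cooling transport `T_* μ_{Λ,β₀} = μ_{Λ,β}` (`0 ≤ β₀ ≤ β`) of `SU(N)` Wilson laws satisfies
  `(N² - 1)·#E·log K ≥ (β - β₀)·(S(U) - ⟨S⟩_{β₀})` for EVERY configuration `U` — at `N = 3` (`calibratedCoolingWindow_zero_su3`,
  every `d`; `d = 4`: `#E = 4L⁴`): `8·#E·log Lip T ≥ (β - β₀)·(S(U) - ⟨S⟩_{β₀})` (`SUN.calibratedWindow` had an unspecified constant).

The instance arguments of the items are written out (`Subtype.metricSpace` and the tree's `SUN.*_hs` instances), as in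
`Scaling/ExactTransportSUN.lean`.  Nothing here is cited as a fact (von Neumann 1929 / Cartan's closed-subgroup theorem
and `det exp = exp tr` are PROVED in the imported Literature files).
-/

noncomputable section

open scoped Matrix.Norms.Frobenius Matrix
open MeasureTheory Metric Set Filter Topology NormedSpace
open Literature.MathematicalPhysics.QuantumFieldTheory
open Literature.MathematicalPhysics.QuantumFieldTheory.UnitaryCayley (𝔼 skewOf unskew skewOf_unskew
  conjTranspose_skewOf finrank_𝔼 unskew_zero)
open Literature.MathematicalPhysics.QuantumLattice (fundamentalRep continuous_fundamentalRep)

namespace Summit.Ventures.LatticeQCDFlow.Theory2.Lattice.SUN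

variable {N : ℕ}

/-! ## §1. The Lie algebra `𝔰𝔲(N)` in Hilbert–Schmidt coordinates -/

variable (N) in
/-- `a ↦ Im tr(skewOf a)`, a real linear functional on `ℝ^{N²} ≅ 𝔲(N)`. [folklore] -/
def imTrace : 𝔼 N →ₗ[ℝ] ℝ :=
  Complex.imLm ∘ₗ ((Matrix.traceLinearMap (Fin N) ℂ ℂ).restrictScalars ℝ) ∘ₗ (skewOf (N := N)).toLinearMap

/-- `imTrace a = Im tr(skewOf a)`. [folklore] -/
theorem imTrace_apply (a : 𝔼 N) : imTrace N a = (skewOf a).trace.im := rfl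

variable (N) in
/-- **The Lie algebra `𝔰𝔲(N)`** in the coordinates `skewOf : ℝ^{N²} ≅ 𝔲(N)`: the `a` with `tr(skewOf a) = 0` (the real
part vanishes automatically for a skew-Hermitian matrix). [folklore] -/
def suAlg : Submodule ℝ (𝔼 N) := LinearMap.ker (imTrace N)

/-- The trace of a skew-Hermitian matrix is purely imaginary. [folklore] -/
theorem re_trace_skewOf (a : 𝔼 N) : (skewOf a).trace.re = 0 := by
  have h : ((skewOf a)ᴴ).trace = (-(skewOf a)).trace := by rw [conjTranspose_skewOf]
  rw [Matrix.trace_conjTranspose, Matrix.trace_neg, Complex.star_def] at h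
  have h2 := congrArg Complex.re h
  rw [Complex.conj_re, Complex.neg_re] at h2
  linarith

/-- Members of `𝔰𝔲(N)` are traceless. [folklore] -/
theorem trace_skewOf_eq_zero (a : suAlg N) : (skewOf (a : 𝔼 N)).trace = 0 := by
  apply Complex.ext
  · rw [re_trace_skewOf, Complex.zero_re]
  · have h : imTrace N (a : 𝔼 N) = 0 := LinearMap.mem_ker.1 a.2
    rw [imTrace_apply] at h
    rw [h, Complex.zero_im]

/-- A traceless skew-Hermitian matrix has coordinates in `𝔰𝔲(N)`. [folklore] -/
theorem unskew_mem_suAlg {X : Matrix (Fin N) (Fin N) ℂ} (hX : Xᴴ = -X) (htr : X.trace = 0) :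
    unskew X ∈ suAlg N := by
  rw [suAlg, LinearMap.mem_ker, imTrace_apply, skewOf_unskew hX, htr, Complex.zero_im]

/-- `i·1 ∈ 𝔲(N)` has `Im tr = N`. [folklore] -/
theorem imTrace_unskew_I_smul_one :
    imTrace N (unskew ((Complex.I : ℂ) • (1 : Matrix (Fin N) (Fin N) ℂ))) = N := by
  have hX : ((Complex.I : ℂ) • (1 : Matrix (Fin N) (Fin N) ℂ))ᴴ = -((Complex.I : ℂ) • 1) := by
    rw [Matrix.conjTranspose_smul, Matrix.conjTranspose_one, Complex.star_def, Complex.conj_I, neg_smul]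
  rw [imTrace_apply, skewOf_unskew hX, Matrix.trace_smul, Matrix.trace_one, smul_eq_mul]
  simp

/-- **`dim 𝔰𝔲(N) = N² - 1`** (`N ≥ 1`; rank–nullity for the surjective functional `Im tr`). [folklore] -/
theorem finrank_suAlg [NeZero N] : Module.finrank ℝ (suAlg N) = N * N - 1 := by
  have hsurj : LinearMap.range (imTrace N) = ⊤ := by
    rw [LinearMap.range_eq_top]
    intro y
    refine ⟨(y / N) • unskew ((Complex.I : ℂ) • (1 : Matrix (Fin N) (Fin N) ℂ)), ?_⟩
    rw [map_smul, imTrace_unskew_I_smul_one, smul_eq_mul]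
    have hN : (N : ℝ) ≠ 0 := Nat.cast_ne_zero.2 (NeZero.ne N)
    field_simp
  have h := LinearMap.finrank_range_add_finrank_ker (imTrace N)
  rw [hsurj, finrank_top, Module.finrank_self, finrank_𝔼] at h
  rw [suAlg]
  omega

/-! ## §2. The exponential chart of `SU(N)` -/

/-- `exp` of a traceless skew-Hermitian matrix is special unitary (`det exp = exp tr`). [folklore] -/
theorem exp_skewOf_mem (a : suAlg N) :
    exp (skewOf (a : 𝔼 N)) ∈ Matrix.specialUnitaryGroup (Fin N) ℂ := by
  rw [Matrix.mem_specialUnitaryGroup_iff]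
  refine ⟨exp_mem_unitary_of_mem_skewAdjoint ?_, ?_⟩
  · rw [skewAdjoint.mem_iff, Matrix.star_eq_conjTranspose, conjTranspose_skewOf]
  · rw [Literature.Analysis.Matrix.det_exp_eq_exp_trace, trace_skewOf_eq_zero, exp_zero]

/-- **The exponential chart** `a ↦ exp(skewOf a)` of `SU(N)` on `𝔰𝔲(N)`. [folklore] -/
def suChart (a : suAlg N) : Matrix.specialUnitaryGroup (Fin N) ℂ := ⟨exp (skewOf (a : 𝔼 N)), exp_skewOf_mem a⟩

/-- Underlying matrix of the chart. [folklore] -/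
theorem coe_suChart (a : suAlg N) : (suChart a : Matrix (Fin N) (Fin N) ℂ) = exp (skewOf (a : 𝔼 N)) := rfl

/-- `suChart 0 = 1`. [folklore] -/
theorem suChart_zero : suChart (0 : suAlg N) = 1 := by
  apply Subtype.ext
  rw [coe_suChart, Submodule.coe_zero, map_zero, exp_zero]
  rfl

/-- The chart is continuous. [folklore] -/
theorem continuous_suChart : Continuous (suChart (N := N)) := by
  apply Continuous.subtype_mk
  exact exp_continuous.comp ((skewOf (N := N)).continuous.comp continuous_subtype_val)

/-- Distances in the chart are Frobenius distances of exponentials; distances in `𝔰𝔲(N)` are Frobenius distances of the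
matrices. [folklore] -/
theorem dist_suChart (a b : suAlg N) :
    dist (suChart a) (suChart b) = ‖exp (skewOf (a : 𝔼 N)) - exp (skewOf (b : 𝔼 N))‖ ∧
      ‖a - b‖ = ‖skewOf (a : 𝔼 N) - skewOf (b : 𝔼 N)‖ := by
  refine ⟨by rw [Subtype.dist_eq, dist_eq_norm]; rfl, ?_⟩
  rw [← map_sub, LinearIsometry.norm_map, ← Submodule.coe_sub, Submodule.norm_coe]

/-- **First-order control of `exp` at `0`**: for every `c > 0` there is `δ > 0` with
`‖exp X - exp Y - (X - Y)‖ ≤ c·‖X - Y‖` whenever `‖X‖, ‖Y‖ < δ` (strict differentiability of `exp` at `0` with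
derivative the identity, Mathlib `hasStrictFDerivAt_exp_zero`). [folklore] -/
theorem exp_sub_exp_approx {c : ℝ} (hc : 0 < c) : ∃ δ : ℝ, 0 < δ ∧ ∀ X Y : Matrix (Fin N) (Fin N) ℂ,
    ‖X‖ < δ → ‖Y‖ < δ → ‖exp X - exp Y - (X - Y)‖ ≤ c * ‖X - Y‖ := by
  have h := (hasStrictFDerivAt_exp_zero (𝕂 := ℝ) (𝔸 := Matrix (Fin N) (Fin N) ℂ)).isLittleO.def hc
  obtain ⟨δ, hδ, hball⟩ := Metric.eventually_nhds_iff.1 h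
  refine ⟨δ, hδ, fun X Y hX hY => ?_⟩
  have hXY : dist (X, Y) ((0 : Matrix (Fin N) (Fin N) ℂ), (0 : Matrix (Fin N) (Fin N) ℂ)) < δ := by
    rw [Prod.dist_eq, dist_zero_right, dist_zero_right]; exact max_lt hX hY
  have h' := hball hXY
  rw [one_apply_eq_self] at h'
  exact h'

/-- **The chart is `(1+ε)`-bi-Lipschitz on small balls**, for every `ε > 0`. [folklore] -/
theorem suChart_biLipschitz {ε : ℝ} (hε : 0 < ε) {r₀ : ℝ} (hr₀ : 0 < r₀) : ∃ r : ℝ, 0 < r ∧ r ≤ r₀ ∧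
    (∀ a ∈ closedBall (0 : suAlg N) r, ∀ b ∈ closedBall (0 : suAlg N) r,
      dist (suChart a) (suChart b) ≤ (1 + ε) * ‖a - b‖) ∧
    (∀ a ∈ closedBall (0 : suAlg N) r, ∀ b ∈ closedBall (0 : suAlg N) r,
      ‖a - b‖ ≤ (1 + ε) * dist (suChart a) (suChart b)) := by
  set c := ε / (1 + ε) with hc
  have hc0 : 0 < c := by positivity
  have hcε : c ≤ ε := by rw [hc, div_le_iff₀ (by linarith)]; nlinarith
  have hc1 : 1 - c = 1 / (1 + ε) := by rw [hc]; field_simp; ring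
  obtain ⟨δ, hδ, hap⟩ := exp_sub_exp_approx (N := N) hc0
  refine ⟨min (δ / 2) r₀, lt_min (by positivity) hr₀, min_le_right _ _, fun a ha b hb => ?_, fun a ha b hb => ?_⟩
  all_goals
    rw [mem_closedBall, dist_zero_right] at ha hb
    have ha' : ‖skewOf (a : 𝔼 N)‖ < δ := by
      rw [LinearIsometry.norm_map, Submodule.norm_coe]; linarith [min_le_left (δ / 2) r₀]
    have hb' : ‖skewOf (b : 𝔼 N)‖ < δ := by
      rw [LinearIsometry.norm_map, Submodule.norm_coe]; linarith [min_le_left (δ / 2) r₀]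
    have h := hap _ _ ha' hb'
    obtain ⟨hd, hn⟩ := dist_suChart a b
    rw [hd, hn]
    rw [← hn] at h ⊢
  · calc ‖exp (skewOf (a : 𝔼 N)) - exp (skewOf (b : 𝔼 N))‖
        = ‖(exp (skewOf (a : 𝔼 N)) - exp (skewOf (b : 𝔼 N)) - (skewOf (a : 𝔼 N) - skewOf (b : 𝔼 N))) +
            (skewOf (a : 𝔼 N) - skewOf (b : 𝔼 N))‖ := by rw [sub_add_cancel]
      _ ≤ c * ‖a - b‖ + ‖a - b‖ := by
          refine (norm_add_le _ _).trans (add_le_add h ?_); rw [hn]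
      _ ≤ (1 + ε) * ‖a - b‖ := by nlinarith [norm_nonneg (a - b)]
  · have h1 : ‖a - b‖ ≤ ‖exp (skewOf (a : 𝔼 N)) - exp (skewOf (b : 𝔼 N))‖ + c * ‖a - b‖ := by
      calc ‖a - b‖ = ‖skewOf (a : 𝔼 N) - skewOf (b : 𝔼 N)‖ := hn
        _ = ‖(exp (skewOf (a : 𝔼 N)) - exp (skewOf (b : 𝔼 N))) -
              (exp (skewOf (a : 𝔼 N)) - exp (skewOf (b : 𝔼 N)) - (skewOf (a : 𝔼 N) - skewOf (b : 𝔼 N)))‖ := by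
            rw [sub_sub_cancel]
        _ ≤ _ := (norm_sub_le _ _).trans (add_le_add le_rfl h)
    have h2 : (1 - c) * ‖a - b‖ ≤ ‖exp (skewOf (a : 𝔼 N)) - exp (skewOf (b : 𝔼 N))‖ := by linarith
    rw [hc1, div_mul_eq_mul_div, one_mul, div_le_iff₀ (by linarith)] at h2
    linarith

/-- **One-parameter generators of `U(N)` are skew-Hermitian**: if `exp(tX)` is unitary for all real `t` then `Xᴴ = -X`
(differentiate `exp(tXᴴ)·exp(tX) = 1` at `t = 0`). [folklore] -/
theorem conjTranspose_eq_neg_of_forall_exp_mem {X : Matrix (Fin N) (Fin N) ℂ}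
    (hX : ∀ t : ℝ, exp (t • X) ∈ Matrix.unitaryGroup (Fin N) ℂ) : Xᴴ = -X := by
  have hone : ∀ t : ℝ, exp (t • Xᴴ) * exp (t • X) = 1 := fun t => by
    have h := Matrix.mem_unitaryGroup_iff'.1 (hX t)
    rwa [star_exp, star_smul, star_trivial, Matrix.star_eq_conjTranspose] at h
  have h1 := hasDerivAt_exp_smul_const (𝕂 := ℝ) Xᴴ (0 : ℝ)
  have h2 := hasDerivAt_exp_smul_const (𝕂 := ℝ) X (0 : ℝ)
  have h12 := (h1.mul h2).congr_of_eventuallyEq (f₁ := fun _ : ℝ => (1 : Matrix (Fin N) (Fin N) ℂ))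
    (Eventually.of_forall fun t => (hone t).symm)
  simp only [zero_smul, exp_zero, one_mul, mul_one] at h12
  have h0 := (hasDerivAt_const (0 : ℝ) (1 : Matrix (Fin N) (Fin N) ℂ)).unique h12
  exact eq_neg_of_add_eq_zero_left h0.symm

/-- **One-parameter generators of `SU(N)` are traceless**: if `exp(tX) ∈ SU(N)` for all real `t` then `tr X = 0`
(differentiate `exp(t·tr X) = det exp(tX) = 1` at `t = 0`). [folklore] -/
theorem trace_eq_zero_of_forall_exp_mem {X : Matrix (Fin N) (Fin N) ℂ}
    (hX : ∀ t : ℝ, exp (t • X) ∈ Matrix.specialUnitaryGroup (Fin N) ℂ) : X.trace = 0 := by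
  have hone : ∀ t : ℝ, exp (t • X.trace) = (1 : ℂ) := fun t => by
    have h := (Matrix.mem_specialUnitaryGroup_iff.1 (hX t)).2
    rwa [Literature.Analysis.Matrix.det_exp_eq_exp_trace, Matrix.trace_smul] at h
  have h1 := (hasDerivAt_exp_smul_const (𝕂 := ℝ) X.trace (0 : ℝ)).congr_of_eventuallyEq
    (f₁ := fun _ : ℝ => (1 : ℂ)) (Eventually.of_forall fun t => (hone t).symm)
  rw [zero_smul, exp_zero, one_mul] at h1
  exact ((hasDerivAt_const (0 : ℝ) (1 : ℂ)).unique h1).symm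

/-- **The exponential chart fills `SU(N)` near `1`** (von Neumann 1929 / Cartan): there is `r₀ > 0` such that every
`U ∈ SU(N)` with `‖U - 1‖ ≤ s ≤ r₀` is `suChart a` with `‖a‖ ≤ 2s`. [folklore] -/
theorem suChart_fill : ∃ r₀ : ℝ, 0 < r₀ ∧ ∀ s : ℝ, 0 ≤ s → s ≤ r₀ →
    closedBall (1 : Matrix.specialUnitaryGroup (Fin N) ℂ) s ⊆ suChart '' closedBall (0 : suAlg N) (2 * s) := by
  set H : Set (Matrix (Fin N) (Fin N) ℂ) := (Matrix.specialUnitaryGroup (Fin N) ℂ : Set (Matrix (Fin N) (Fin N) ℂ))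
    with hH
  have hHc : IsClosed H :=
    (isCompact_iff_compactSpace.2 (inferInstance : CompactSpace (Matrix.specialUnitaryGroup (Fin N) ℂ))).isClosed
  have h1 : (1 : Matrix (Fin N) (Fin N) ℂ) ∈ H := Submonoid.one_mem _
  have hmul : ∀ a ∈ H, ∀ b ∈ H, a * b ∈ H := fun a ha b hb => Submonoid.mul_mem _ ha hb
  have hinv : ∀ a ∈ H, ∃ b ∈ H, b * a = 1 := by
    intro a ha
    refine ⟨((⟨a, ha⟩ : Matrix.specialUnitaryGroup (Fin N) ℂ)⁻¹ : Matrix.specialUnitaryGroup (Fin N) ℂ),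
      Subtype.coe_prop _, ?_⟩
    have := congrArg Subtype.val (inv_mul_cancel (⟨a, ha⟩ : Matrix.specialUnitaryGroup (Fin N) ℂ))
    exact this
  obtain ⟨r, hr, hchart⟩ :=
    Literature.Analysis.Calculus.exists_exp_chart_of_isClosed (𝔸 := Matrix (Fin N) (Fin N) ℂ) hHc h1 hmul hinv
  refine ⟨r / 2, by positivity, fun s hs hsr U hU => ?_⟩
  rw [mem_closedBall, Subtype.dist_eq, dist_eq_norm] at hU
  have hU' : ‖(U : Matrix (Fin N) (Fin N) ℂ) - 1‖ < r := by
    have : ((1 : Matrix.specialUnitaryGroup (Fin N) ℂ) : Matrix (Fin N) (Fin N) ℂ) = 1 := rfl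
    rw [this] at hU; linarith
  obtain ⟨X, hXt, hXU, hXn⟩ := hchart U U.2 hU'
  have hXskew : Xᴴ = -X :=
    conjTranspose_eq_neg_of_forall_exp_mem fun t => (Matrix.mem_specialUnitaryGroup_iff.1 (hXt t)).1
  have hXtr : X.trace = 0 := trace_eq_zero_of_forall_exp_mem hXt
  refine ⟨⟨unskew X, unskew_mem_suAlg hXskew hXtr⟩, ?_, ?_⟩
  · rw [mem_closedBall, dist_zero_right, Submodule.coe_norm, Submodule.coe_mk, ← (skewOf (N := N)).norm_map,
      skewOf_unskew hXskew]
    have : ((1 : Matrix.specialUnitaryGroup (Fin N) ℂ) : Matrix (Fin N) (Fin N) ℂ) = 1 := rfl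
    rw [this] at hU
    linarith
  · apply Subtype.ext
    rw [coe_suChart]
    change exp (skewOf (unskew X)) = (U : Matrix (Fin N) (Fin N) ℂ)
    rw [skewOf_unskew hXskew]
    exact hXU

/-! ## §3. Small-ball asymptotics of `SU(N)` and the constant-free calibrated window laws -/

/-- Haar masses of Hilbert–Schmidt balls of `SU(N)` do not depend on the centre. [folklore] -/
theorem haar_closedBall_eq_one (g : Matrix.specialUnitaryGroup (Fin N) ℂ) (r : ℝ) :
    haarProbability (Matrix.specialUnitaryGroup (Fin N) ℂ) (closedBall g r) =
      haarProbability (Matrix.specialUnitaryGroup (Fin N) ℂ) (closedBall 1 r) := by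
  rw [haar_closedBall g, haar_closedBall 1]

/-- **Exact small-ball asymptotics of `SU(N)`** (`N ≥ 1`, Hilbert–Schmidt metric): there is `C₀ > 0` with
`Haar(B̄(1, t))/t^{N²-1} → C₀` as `t → 0⁺` (the exponential chart fed into `Scaling/SmallBallChartLimit.lean`).
[folklore] -/
theorem exists_tendsto_haar_closedBall_div_pow [NeZero N] :
    ∃ C₀ : ℝ, 0 < C₀ ∧ Tendsto (fun t : ℝ =>
      (haarProbability (Matrix.specialUnitaryGroup (Fin N) ℂ)
        (closedBall (1 : Matrix.specialUnitaryGroup (Fin N) ℂ) t)).toReal / t ^ (N * N - 1)) (𝓝[>] 0) (𝓝 C₀) := by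
  obtain ⟨r₀, hr₀, hfill⟩ := suChart_fill (N := N)
  -- the tree's Borel / open-positivity instances of `SU(N)`, at the Hilbert–Schmidt metric topology
  haveI := borelSpace_hs (N := N)
  haveI : @Measure.IsOpenPosMeasure (Matrix.specialUnitaryGroup (Fin N) ℂ) (@UniformSpace.toTopologicalSpace _
      (@PseudoMetricSpace.toUniformSpace _ (@MetricSpace.toPseudoMetricSpace _ Subtype.metricSpace))) _
      (haarProbability (Matrix.specialUnitaryGroup (Fin N) ℂ)) :=
    (inferInstance : (haarProbability (Matrix.specialUnitaryGroup (Fin N) ℂ)).IsOpenPosMeasure)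
  have h := SmallBallChart.exists_tendsto_measure_closedBall_div_pow
    (haarProbability (Matrix.specialUnitaryGroup (Fin N) ℂ)) (Measure.addHaar : Measure (suAlg N))
    (φ := suChart) (x₀ := 1) (r₀ := r₀) (Λ₀ := 2) haar_closedBall_eq_one
    (fun ρ hρ => Metric.measure_closedBall_pos _ _ hρ) suChart_zero continuous_suChart.continuousOn
    (fun ε hε => suChart_biLipschitz hε hr₀) (by norm_num) hfill
  rwa [finrank_suAlg] at h

/-- **`SmallBallAsymptotics SU(N) (N²-1)` — theory-2's hypothesis item DISCHARGED for `SU(N)`** (`N ≥ 1`,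
Hilbert–Schmidt metric; `SU(3)` included): for every `ε > 0` there are `r₁ > 0`, `0 < a`, `A ≤ (1+ε)a` with
`a·t^{N²-1} ≤ Haar(B̄(g,t)) ≤ A·t^{N²-1}` for all `g` and `0 < t ≤ r₁`. [folklore] -/
theorem smallBallAsymptotics (N : ℕ) [NeZero N] :
    @SmallBallAsymptotics (Matrix.specialUnitaryGroup (Fin N) ℂ) _ Subtype.metricSpace isTopologicalGroup_hs
      compactSpace_hs _ borelSpace_hs (N * N - 1) := by
  obtain ⟨C₀, hC₀, hT⟩ := exists_tendsto_haar_closedBall_div_pow (N := N)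
  exact SmallBallChart.two_sided_of_tendsto (σ := haarProbability (Matrix.specialUnitaryGroup (Fin N) ℂ))
    (x₀ := (1 : Matrix.specialUnitaryGroup (Fin N) ℂ)) haar_closedBall_eq_one hC₀ hT

/-- **(C2a-W⁺) CONSTANT-FREE for `SU(N)`** (OURS; every `N ≥ 1`, `d`, Hilbert–Schmidt metric; `SU(3)`, `d = 4`
included): every exact `K`-Lipschitz cooling transport `T_* μ_{Λ,β₀} = μ_{Λ,β}`, `0 ≤ β₀ ≤ β`, of `SU(N)` Wilson laws
(fundamental representation) satisfies `(β - β₀)·(S(U) - ⟨S⟩_{Λ,β₀}) ≤ (N² - 1)·#E·log K` for every `L` and EVERY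
configuration `U`; at `N = 3`, `d = 4`: `8·#E·log Lip T ≥ (β - β₀)·(S(U) - ⟨S⟩_{β₀})`, `#E = 4L⁴`. [folklore] -/
theorem calibratedCoolingWindow_zero (d N : ℕ) (hN : 1 ≤ N) :
    @CalibratedCoolingWindow d N (Matrix.specialUnitaryGroup (Fin N) ℂ) _ Subtype.metricSpace
      isTopologicalGroup_hs compactSpace_hs _ borelSpace_hs (fundamentalRep (Fin N)) (N * N - 1) 0 := by
  haveI : NeZero N := ⟨by omega⟩
  exact @calibratedCoolingWindow_of_smallBallAsymptotics N (Matrix.specialUnitaryGroup (Fin N) ℂ) _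
    Subtype.metricSpace isTopologicalGroup_hs compactSpace_hs secondCountable_hs _ borelSpace_hs
    (fundamentalRep (Fin N)) d (continuous_fundamentalRep (Fin N)) (SUN.re_trace_le N) neg_le_re_trace (N * N - 1)
    (smallBallAsymptotics N)

/-- **(C2a-H⁺) CONSTANT-FREE for `SU(N)`** (OURS; `N ≥ 1`): every exact `K'`-co-Lipschitz heating transport
`T_* μ_{Λ,β₀} = μ_{Λ,β}`, `0 ≤ β ≤ β₀`, of `SU(N)` Wilson laws satisfies
`(β₀ - β)·(S(U) - ⟨S⟩_{Λ,β}) ≤ (N² - 1)·#E·log K'` for every `L` and every `U`. [folklore] -/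
theorem calibratedHeatingWindow_zero (d N : ℕ) (hN : 1 ≤ N) :
    @CalibratedHeatingWindow d N (Matrix.specialUnitaryGroup (Fin N) ℂ) _ Subtype.metricSpace
      isTopologicalGroup_hs compactSpace_hs _ borelSpace_hs (fundamentalRep (Fin N)) (N * N - 1) 0 := by
  haveI : NeZero N := ⟨by omega⟩
  exact @calibratedHeatingWindow_of_smallBallAsymptotics N (Matrix.specialUnitaryGroup (Fin N) ℂ) _
    Subtype.metricSpace isTopologicalGroup_hs compactSpace_hs secondCountable_hs _ borelSpace_hs
    (fundamentalRep (Fin N)) d (continuous_fundamentalRep (Fin N)) (SUN.re_trace_le N) (N * N - 1)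
    (smallBallAsymptotics N)

/-- **`SU(3)` reading** (OURS; every `d`, in particular `d = 4` with `#E = 4L⁴`): every exact `K`-Lipschitz cooling
transport of `SU(3)` Wilson laws, `0 ≤ β₀ ≤ β`, satisfies `(β - β₀)·(S(U) - ⟨S⟩_{Λ,β₀}) ≤ 8·#E·log K` for every `L` and
every configuration `U` — no constant, no hypothesis. [folklore] -/
theorem calibratedCoolingWindow_zero_su3 (d : ℕ) :
    @CalibratedCoolingWindow d 3 (Matrix.specialUnitaryGroup (Fin 3) ℂ) _ Subtype.metricSpace
      isTopologicalGroup_hs compactSpace_hs _ borelSpace_hs (fundamentalRep (Fin 3)) 8 0 := by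
  have h := calibratedCoolingWindow_zero d 3 (by norm_num : 1 ≤ 3)
  exact h

end Summit.Ventures.LatticeQCDFlow.Theory2.Lattice.SUN

end
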